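import Literature.Analysis.Complex.StripResidueFormula
import Literature.Analysis.SpecialFunctions.InvSqAddSqIntegral
import Mathlib.Analysis.Fourier.Inversion
import Mathlib.Analysis.SpecialFunctions.ImproperIntegrals
import HarnessLib

/-!
# RiemannHypothesis / DBN — Fourier calculus of the Cauchy (Poisson) kernel

RH-FREE support lemmas for the `pub-dbn` cell's Sketch4 targets F1/F1′ (THEORY-R4 §2,
`Sketch4.lean` sha16 3a8b9a024097398f; proved in `Theorems/DBNStripRepresentation.lean`):

* `integral_exp_mul_sub_mul_abs` — the two-sided exponential integral
  `∫ e^{γw − δ|w|} dw = 1/(δ−γ) + 1/(δ+γ)` (`|Re γ| < δ`), from Mathlib's half-line integrals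
  `integral_exp_mul_complex_Ioi/Iic`;
* `fourierInv_pi_mul_exp_neg`, `fourier_cauchyC` — the Cauchy kernel `a/(s²+a²)` is the inverse Fourier
  transform of `π e^{−2πa|w|}` (Mathlib normalisation), hence `𝓕[a/(s²+a²)] = π e^{−2πa|w|}` by Fourier
  inversion (`Continuous.fourier_fourierInv_eq`);
* `integral_cexp_mul_twoSided` — `∫ e^{2πivx} π(e^{2πηv}+e^{−2πηv}) e^{−2πc|v|} dv
  = (c−η)/(x²+(c−η)²) + (c+η)/(x²+(c+η)²)` for `|η| < c`: the inverse Fourier integral that evaluates the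
  strip-Poisson smoothing of the descent and probe kernels.

Pure real/complex calculus; nothing here bears on the truth of RH.  `--supports stmt-RiemannHypothesis-0274`.
-/

noncomputable section

-- D-0017: `Summit.<S>.<S>.…` is the designed namespace of a single-problem summit.
set_option linter.dupNamespace false

open scoped Real FourierTransform
open MeasureTheory Set Filter Complex

namespace Summit.RiemannHypothesis.RiemannHypothesis.Theorems.DbnTheory

/-! ## Two-sided exponential integrals -/

/-- On `(0, ∞)` the integrand `e^{γw − δ|w|}` is `e^{(γ−δ)w}`; on `(−∞, 0]` it is `e^{(γ+δ)w}`. [folklore] -/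
theorem exp_mul_sub_mul_abs_of_pos (γ : ℂ) (δ : ℝ) {w : ℝ} (hw : 0 < w) :
    Complex.exp (γ * w - δ * |w|) = Complex.exp ((γ - δ) * w) := by
  rw [abs_of_pos hw]; ring_nf

/-- See `exp_mul_sub_mul_abs_of_pos`. [folklore] -/
theorem exp_mul_sub_mul_abs_of_nonpos (γ : ℂ) (δ : ℝ) {w : ℝ} (hw : w ≤ 0) :
    Complex.exp (γ * w - δ * |w|) = Complex.exp ((γ + δ) * w) := by
  rw [abs_of_nonpos hw]; push_cast; ring_nf

/-- `w ↦ e^{γw − δ|w|}` is integrable on `ℝ` when `|Re γ| < δ`. [folklore] -/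
theorem integrable_exp_mul_sub_mul_abs {γ : ℂ} {δ : ℝ} (h : |γ.re| < δ) :
    Integrable fun w : ℝ => Complex.exp (γ * w - δ * |w|) := by
  obtain ⟨h1, h2⟩ := abs_lt.mp h
  have hIoi : IntegrableOn (fun w : ℝ => Complex.exp (γ * w - δ * |w|)) (Ioi 0) := by
    refine (integrableOn_exp_mul_complex_Ioi (a := γ - δ) (by simp; linarith) 0).congr_fun
      (fun w hw => (exp_mul_sub_mul_abs_of_pos γ δ hw).symm) measurableSet_Ioi
  have hIic : IntegrableOn (fun w : ℝ => Complex.exp (γ * w - δ * |w|)) (Iic 0) := by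
    refine (integrableOn_exp_mul_complex_Iic (a := γ + δ) (by simp; linarith) 0).congr_fun
      (fun w hw => (exp_mul_sub_mul_abs_of_nonpos γ δ hw).symm) measurableSet_Iic
  have := hIic.union hIoi
  rwa [Iic_union_Ioi, integrableOn_univ] at this

/-- **Two-sided exponential integral**: `∫ e^{γw − δ|w|} dw = 1/(δ−γ) + 1/(δ+γ)` for `|Re γ| < δ`.
[folklore] -/
theorem integral_exp_mul_sub_mul_abs {γ : ℂ} {δ : ℝ} (h : |γ.re| < δ) :
    ∫ w : ℝ, Complex.exp (γ * w - δ * |w|) = 1 / (δ - γ) + 1 / (δ + γ) := by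
  obtain ⟨h1, h2⟩ := abs_lt.mp h
  have ha : (γ - δ).re < 0 := by simp; linarith
  have hb : 0 < (γ + δ).re := by simp; linarith
  have hIoi : IntegrableOn (fun w : ℝ => Complex.exp (γ * w - δ * |w|)) (Ioi 0) := by
    refine (integrableOn_exp_mul_complex_Ioi ha 0).congr_fun
      (fun w hw => (exp_mul_sub_mul_abs_of_pos γ δ hw).symm) measurableSet_Ioi
  have hIic : IntegrableOn (fun w : ℝ => Complex.exp (γ * w - δ * |w|)) (Iic 0) := by
    refine (integrableOn_exp_mul_complex_Iic hb 0).congr_fun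
      (fun w hw => (exp_mul_sub_mul_abs_of_nonpos γ δ hw).symm) measurableSet_Iic
  rw [← intervalIntegral.integral_Iic_add_Ioi hIic hIoi,
    setIntegral_congr_fun measurableSet_Iic (fun w hw => exp_mul_sub_mul_abs_of_nonpos γ δ hw),
    setIntegral_congr_fun measurableSet_Ioi (fun w hw => exp_mul_sub_mul_abs_of_pos γ δ hw),
    integral_exp_mul_complex_Iic hb 0, integral_exp_mul_complex_Ioi ha 0]
  have hne1 : (δ : ℂ) - γ ≠ 0 := by
    intro h0; have := congrArg Complex.re h0; simp at this; linarith
  have hne2 : (δ : ℂ) + γ ≠ 0 := by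
    intro h0; have := congrArg Complex.re h0; simp at this; linarith
  have hne3 : γ - δ ≠ 0 := by
    intro h0; apply hne1; linear_combination -h0
  have hne4 : γ + δ ≠ 0 := by
    intro h0; apply hne2; linear_combination h0
  push_cast
  simp only [mul_zero, Complex.exp_zero]
  field_simp
  ring

/-- `1/(b − iξ) + 1/(b + iξ) = 2b/(b² + ξ²)` (real `b ≠ 0`, `ξ`). [folklore] -/
theorem one_div_sub_I_add_one_div_add_I {b : ℝ} (hb : b ≠ 0) (ξ : ℝ) :
    1 / ((b : ℂ) - ξ * I) + 1 / ((b : ℂ) + ξ * I) = ((2 * b / (b ^ 2 + ξ ^ 2) : ℝ) : ℂ) := by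
  have hpos : 0 < b ^ 2 + ξ ^ 2 := by positivity
  have h1 : (b : ℂ) - ξ * I ≠ 0 := by
    intro h0; have := congrArg Complex.re h0; simp at this; exact hb this
  have h2 : (b : ℂ) + ξ * I ≠ 0 := by
    intro h0; have := congrArg Complex.re h0; simp at this; exact hb this
  have h3 : (b : ℂ) ^ 2 + (ξ : ℂ) ^ 2 ≠ 0 := by exact_mod_cast hpos.ne'
  push_cast
  field_simp
  linear_combination (2 * b * ξ ^ 2 : ℂ) * I_mul_I

/-! ## The Cauchy kernel as an inverse Fourier transform -/

/-- `∫ e^{2πiws} · π e^{−2πa|w|} dw = a/(s² + a²)`: the Cauchy (Poisson) kernel `a/(s²+a²)` is the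
inverse Fourier transform of `π e^{−2πa|w|}` (`a > 0`). [folklore] -/
theorem fourierInv_pi_mul_exp_neg (a : ℝ) (ha : 0 < a) (s : ℝ) :
    𝓕⁻ (fun w : ℝ => ((π * Real.exp (-(2 * π * a * |w|)) : ℝ) : ℂ)) s = ((a / (s ^ 2 + a ^ 2) : ℝ) : ℂ) := by
  rw [Real.fourierInv_eq_fourier_neg, Real.fourier_real_eq_integral_exp_smul]
  have hγ : |(2 * π * s * I : ℂ).re| < 2 * π * a := by
    simp; positivity
  have key := integral_exp_mul_sub_mul_abs hγ
  have hfun : ∀ v : ℝ, Complex.exp (↑(-2 * π * v * -s) * I) • (((π * Real.exp (-(2 * π * a * |v|)) : ℝ) : ℂ))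
      = (π : ℂ) * Complex.exp ((2 * π * s * I) * v - (2 * π * a : ℝ) * |v|) := by
    intro v
    rw [smul_eq_mul, sub_eq_add_neg, Complex.exp_add]
    push_cast
    have e1 : Complex.exp (-2 * π * v * -s * I : ℂ) = Complex.exp (2 * π * s * I * v) := by
      congr 1; ring
    have e2 : Complex.exp (-(2 * π * a * |v|) : ℂ) = Complex.exp (-((2 * π * a : ℂ) * |v|)) := by
      congr 1
    rw [e1, e2]
    ring
  simp_rw [hfun]
  rw [MeasureTheory.integral_const_mul, key]
  have hb : (2 * π * a) ≠ 0 := by positivity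
  have h := one_div_sub_I_add_one_div_add_I hb (2 * π * s)
  have e1 : ((2 * π * a : ℝ) : ℂ) - 2 * π * s * I = ((2 * π * a : ℝ) : ℂ) - ((2 * π * s : ℝ) : ℂ) * I := by
    push_cast; ring
  have e2 : ((2 * π * a : ℝ) : ℂ) + 2 * π * s * I = ((2 * π * a : ℝ) : ℂ) + ((2 * π * s : ℝ) : ℂ) * I := by
    push_cast; ring
  rw [e1, e2, h, ← Complex.ofReal_mul]
  congr 1
  have hπ : π ≠ 0 := Real.pi_pos.ne'
  field_simp
  ring

/-- The Cauchy kernel is continuous. [folklore] -/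
theorem continuous_cauchyC (a : ℝ) (ha : 0 < a) :
    Continuous fun s : ℝ => (((a / (s ^ 2 + a ^ 2)) : ℝ) : ℂ) := by
  refine continuous_ofReal.comp (Continuous.div continuous_const (by fun_prop) fun s => ?_)
  positivity

/-- The Cauchy kernel is integrable. [folklore] -/
theorem integrable_cauchyC (a : ℝ) (ha : 0 < a) :
    Integrable fun s : ℝ => (((a / (s ^ 2 + a ^ 2)) : ℝ) : ℂ) := by
  have hreal : Integrable fun s : ℝ => a / (s ^ 2 + a ^ 2) := by
    have h := (Literature.Analysis.SpecialFunctions.integrable_inv_sq_add_sq_of_ne_zero ha.ne').const_mul a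
    refine h.congr (Eventually.of_forall fun s => ?_)
    show a * (a ^ 2 + s ^ 2)⁻¹ = a / (s ^ 2 + a ^ 2)
    rw [div_eq_mul_inv, add_comm]
  exact hreal.ofReal

/-- `w ↦ π e^{−2πa|w|}` is continuous. [folklore] -/
theorem continuous_pi_mul_exp_neg (a : ℝ) :
    Continuous fun w : ℝ => ((π * Real.exp (-(2 * π * a * |w|)) : ℝ) : ℂ) := by
  fun_prop

/-- `w ↦ π e^{−2πa|w|}` is integrable (`a > 0`). [folklore] -/
theorem integrable_pi_mul_exp_neg (a : ℝ) (ha : 0 < a) :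
    Integrable fun w : ℝ => ((π * Real.exp (-(2 * π * a * |w|)) : ℝ) : ℂ) := by
  refine Integrable.ofReal (Integrable.const_mul ?_ π)
  have := Literature.Analysis.Complex.integrable_exp_neg_mul_abs (b := 2 * π * a) (by positivity)
  refine this.congr (Eventually.of_forall fun w => ?_)
  ring_nf

/-- **Fourier transform of the Cauchy kernel**: `𝓕[a/(s²+a²)](w) = π e^{−2πa|w|}` (`a > 0`), by Fourier
inversion from `fourierInv_pi_mul_exp_neg`. [folklore] -/
theorem fourier_cauchyC (a : ℝ) (ha : 0 < a) :
    𝓕 (fun s : ℝ => (((a / (s ^ 2 + a ^ 2)) : ℝ) : ℂ)) = fun w : ℝ => ((π * Real.exp (-(2 * π * a * |w|)) : ℝ) : ℂ) := by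
  have hinv : 𝓕⁻ (fun w : ℝ => ((π * Real.exp (-(2 * π * a * |w|)) : ℝ) : ℂ))
      = fun s : ℝ => (((a / (s ^ 2 + a ^ 2)) : ℝ) : ℂ) := by
    funext s; exact fourierInv_pi_mul_exp_neg a ha s
  rw [← hinv]
  refine (continuous_pi_mul_exp_neg a).fourier_fourierInv_eq (integrable_pi_mul_exp_neg a ha) ?_
  -- `𝓕 E (w) = 𝓕⁻ E (−w) = a/((−w)²+a²)` is integrable
  have hF : 𝓕 (fun w : ℝ => ((π * Real.exp (-(2 * π * a * |w|)) : ℝ) : ℂ))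
      = fun w : ℝ => (((a / ((-w) ^ 2 + a ^ 2)) : ℝ) : ℂ) := by
    funext w
    rw [← fourierInv_pi_mul_exp_neg a ha (-w), Real.fourierInv_eq_fourier_neg, neg_neg]
  rw [hF]
  simpa only [neg_sq] using! integrable_cauchyC a ha

/-! ## Evaluation of the inverse Fourier integrals -/

/-- Modulated integrands stay integrable. [folklore] -/
theorem integrable_cexp_mul {G : ℝ → ℂ} (hG : Integrable G) (x : ℝ) :
    Integrable fun v : ℝ => Complex.exp (↑(-2 * π * v * -x) * I) * G v := by
  refine hG.bdd_mul (c := 1) (by fun_prop : Continuous fun v : ℝ =>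
    Complex.exp (↑(-2 * π * v * -x) * I)).aestronglyMeasurable (Eventually.of_forall fun v => ?_)
  rw [Complex.norm_exp_ofReal_mul_I]

/-- **The basic inverse Fourier integral**: for `|η| < c`,
`∫ e^{2πivx} · π (e^{2πηv} + e^{−2πηv}) e^{−2πc|v|} dv = (c−η)/(x²+(c−η)²) + (c+η)/(x²+(c+η)²)`. [folklore] -/
theorem integral_cexp_mul_twoSided {c η : ℝ} (h : |η| < c) (x : ℝ) :
    ∫ v : ℝ, Complex.exp (↑(-2 * π * v * -x) * I) *
        (((π * (Real.exp (2 * π * η * v) + Real.exp (-(2 * π * η * v))) * Real.exp (-(2 * π * c * |v|))) : ℝ) : ℂ)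
      = ((((c - η) / (x ^ 2 + (c - η) ^ 2) + (c + η) / (x ^ 2 + (c + η) ^ 2)) : ℝ) : ℂ) := by
  obtain ⟨h1, h2⟩ := abs_lt.mp h
  have hc : 0 < c := lt_of_le_of_lt (abs_nonneg η) h
  -- the two exponents
  set γ₁ : ℂ := 2 * π * x * I + 2 * π * η with hγ₁
  set γ₂ : ℂ := 2 * π * x * I - 2 * π * η with hγ₂
  have hre1 : γ₁.re = 2 * π * η := by rw [hγ₁]; simp
  have hre2 : γ₂.re = -(2 * π * η) := by rw [hγ₂]; simp
  have hπη : |2 * π * η| < 2 * π * c := by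
    rw [abs_mul, abs_mul, abs_two, abs_of_pos Real.pi_pos]
    nlinarith [Real.pi_pos, abs_nonneg η]
  have hγ₁re : |γ₁.re| < 2 * π * c := by rwa [hre1]
  have hγ₂re : |γ₂.re| < 2 * π * c := by rwa [hre2, abs_neg]
  have hpt : ∀ v : ℝ, Complex.exp (↑(-2 * π * v * -x) * I) *
        (((π * (Real.exp (2 * π * η * v) + Real.exp (-(2 * π * η * v))) * Real.exp (-(2 * π * c * |v|))) : ℝ) : ℂ)
      = (π : ℂ) * (Complex.exp (γ₁ * v - (2 * π * c : ℝ) * |v|) + Complex.exp (γ₂ * v - (2 * π * c : ℝ) * |v|)) := by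
    intro v
    have e1 : Complex.exp (γ₁ * v - (2 * π * c : ℝ) * |v|) = Complex.exp (↑(-2 * π * v * -x) * I) *
        Complex.exp ((2 * π * η * v : ℝ)) * Complex.exp ((-(2 * π * c * |v|) : ℝ)) := by
      rw [← Complex.exp_add, ← Complex.exp_add]
      congr 1
      rw [hγ₁]; push_cast; ring
    have e2 : Complex.exp (γ₂ * v - (2 * π * c : ℝ) * |v|) = Complex.exp (↑(-2 * π * v * -x) * I) *
        Complex.exp ((-(2 * π * η * v) : ℝ)) * Complex.exp ((-(2 * π * c * |v|) : ℝ)) := by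
      rw [← Complex.exp_add, ← Complex.exp_add]
      congr 1
      rw [hγ₂]; push_cast; ring
    rw [e1, e2]
    push_cast
    ring
  simp_rw [hpt]
  rw [MeasureTheory.integral_const_mul,
    integral_add (integrable_exp_mul_sub_mul_abs hγ₁re) (integrable_exp_mul_sub_mul_abs hγ₂re),
    integral_exp_mul_sub_mul_abs hγ₁re, integral_exp_mul_sub_mul_abs hγ₂re]
  -- pair the four terms
  have hcm : 0 < c - η := by linarith
  have hcp : 0 < c + η := by linarith
  have hb1 : 2 * π * (c - η) ≠ 0 := by positivity
  have hb2 : 2 * π * (c + η) ≠ 0 := by positivity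
  have p1 := one_div_sub_I_add_one_div_add_I hb1 (2 * π * x)
  have p2 := one_div_sub_I_add_one_div_add_I hb2 (2 * π * x)
  have e1 : ((2 * π * c : ℝ) : ℂ) - γ₁ = ((2 * π * (c - η) : ℝ) : ℂ) - ((2 * π * x : ℝ) : ℂ) * I := by
    rw [hγ₁]; push_cast; ring
  have e2 : ((2 * π * c : ℝ) : ℂ) + γ₂ = ((2 * π * (c - η) : ℝ) : ℂ) + ((2 * π * x : ℝ) : ℂ) * I := by
    rw [hγ₂]; push_cast; ring
  have e3 : ((2 * π * c : ℝ) : ℂ) + γ₁ = ((2 * π * (c + η) : ℝ) : ℂ) + ((2 * π * x : ℝ) : ℂ) * I := by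
    rw [hγ₁]; push_cast; ring
  have e4 : ((2 * π * c : ℝ) : ℂ) - γ₂ = ((2 * π * (c + η) : ℝ) : ℂ) - ((2 * π * x : ℝ) : ℂ) * I := by
    rw [hγ₂]; push_cast; ring
  rw [e1, e2, e3, e4]
  rw [show ∀ A B C D : ℂ, A + B + (C + D) = (A + D) + (C + B) from fun A B C D => by ring, p1, p2,
    ← Complex.ofReal_add, ← Complex.ofReal_mul]
  congr 1
  have hπ : π ≠ 0 := Real.pi_pos.ne'
  have hd1 : (c - η) ^ 2 + x ^ 2 ≠ 0 := by positivity
  have hd2 : (c + η) ^ 2 + x ^ 2 ≠ 0 := by positivity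
  field_simp
  ring


end Summit.RiemannHypothesis.RiemannHypothesis.Theorems.DbnTheory

end
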